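import Summits.ResolutionOfSingularities.ResolutionOfSingularities.Theorems.FrobeniusLadderFInjectiveMacaulayficationChartPrincipalIdeal
import HarnessLib

/-!
# BED Ω, GLOBAL PATCH (g-b), F6 GLUE: `L·𝒪` IS INVERTIBLE ON A MONOMIAL BLOW-UP WHOSE CHARTS ATTAIN THE ORDER OF `L` — the hypothesis `hL` of
# ✓ `OmegaCureCentreFactors.exists_cure_fac_of_isEffectiveCartier` from a vertex-chart cover (`g14/F6-ARCHITECTURE.md` (0)/(1); on the refined class model `X̃₂ = Bl_{K″} X` of the global cure
# fan Σ₂ the order data are ✓ `SubconeOrder.hge_of_subcone` + ⊙ `cert_S2_subcones`)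
# (crux `FInjectiveMacaulayfication` stmt-ResolutionOfSingularities-15315, chain w45a; seat res-L1-w45a-stub-3 g14)

[OURS · L1 W4.5a] Support file (`--supports stmt-ResolutionOfSingularities-15315 --as helper`); one theorem; GENERIC (any field, any hypersurface `f`, any monomial centre `A` with a vertex-chart
cover, any monomial ideal `B`); no named fact; NOT a statement of any manuscript; nothing of the crux is proved. AI-written (AI review is weaker than expert review).
* ★★ `isEffectiveCartier_comap_span_monomials` — if the vertex charts `D₊(x^{m_c} t)` (`c : Fin t`) cover `Bl_A X` (irrelevant ideal ⊆ √(x^{m_c} t)), each with a unimodular toric presentation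
  `Γ ≅ k[y]/(θ_c)` (`θ_c` prime, free of variables) and on each the order of `B` is attained at some `b_c ∈ B` (`V_c b_c ≤ V_c e`, `e ∈ B`), then `(x^e : e ∈ B)~·𝒪_{Bl_A X}` is an effective
  Cartier divisor (✓ `ChartPrincipalIdeal.exists_generator_of_chart` at every point, ✓ `MonomialChartSections.exists_mem_chartOpen` for the cover).
[cite: CoxLittleSchenck2011, §3.1, Thm. 3.1.19, §11.1; StacksProject, Tag 0804]
-/

set_option linter.dupNamespace false

noncomputable section

open AlgebraicGeometry CategoryTheory Literature.AlgebraicGeometry.Resolution MvPolynomial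

namespace Summit.ResolutionOfSingularities.ResolutionOfSingularities.Theorems.FInjectiveMacaulayfication.ClassCentreInvertible

open Summit.ResolutionOfSingularities.ResolutionOfSingularities.Theorems.FInjectiveMacaulayfication

variable {n : ℕ} {k : Type} [Field k]

/-- ★★ **`(x^e : e ∈ B)·𝒪_{Bl_A X}` IS AN EFFECTIVE CARTIER DIVISOR** when the vertex charts cover and the order of `B` is attained on each. [OURS · F6 glue; cite: CoxLittleSchenck2011, §3.1, §11.1] -/
theorem isEffectiveCartier_comap_span_monomials (f : MvPolynomial (Fin n) k) (hprime : (Ideal.span {f}).IsPrime)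
    (hXne : ∀ j : Fin n, Ideal.Quotient.mk (Ideal.span {f}) (X j) ≠ 0) (A : Finset (Fin n →₀ ℕ)) (t : ℕ) (m : Fin t → (Fin n →₀ ℕ))
    (hv : ∀ c : Fin t, Ideal.Quotient.mk (Ideal.span {f}) (monomial (m c) (1 : k)) ∈
      Ideal.span ((fun e : Fin n →₀ ℕ => Ideal.Quotient.mk (Ideal.span {f}) (monomial e (1 : k))) '' (A : Set (Fin n →₀ ℕ))))
    (hcov : (HomogeneousIdeal.irrelevant (reesGrading (Ideal.span ((fun e : Fin n →₀ ℕ => Ideal.Quotient.mk (Ideal.span {f}) (monomial e (1 : k))) '' (A : Set (Fin n →₀ ℕ)))))).toIdeal ≤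
      (Ideal.span (Set.range fun c : Fin t => reesT (I := Ideal.span ((fun e : Fin n →₀ ℕ => Ideal.Quotient.mk (Ideal.span {f}) (monomial e (1 : k))) '' (A : Set (Fin n →₀ ℕ))))
        (Ideal.Quotient.mk (Ideal.span {f}) (monomial (m c) (1 : k))) (hv c))).radical)
    (V : Fin t → Matrix (Fin n) (Fin n) ℕ) (hV : ∀ c, IsUnit ((V c).map (Nat.cast : ℕ → ℤ)).det)
    (a : Fin t → Fin n → (Fin n →₀ ℕ)) (haA : ∀ c i, a c i ∈ A)
    (hgen : ∀ (c : Fin t) (i : Fin n), (Finsupp.equivFunOnFinite.symm ((V c).mulVec ⇑(a c i)) : Fin n →₀ ℕ) =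
      Finsupp.equivFunOnFinite.symm ((V c).mulVec ⇑(m c)) + Finsupp.single i 1)
    (hge : ∀ (c : Fin t), ∀ e ∈ A, (Finsupp.equivFunOnFinite.symm ((V c).mulVec ⇑(m c)) : Fin n →₀ ℕ) ≤ Finsupp.equivFunOnFinite.symm ((V c).mulVec ⇑e))
    (d : Fin t → (Fin n →₀ ℕ)) (θ : Fin t → MvPolynomial (Fin n) k)
    (hθ : ∀ c, aeval (fun j : Fin n => ∏ i : Fin n, (X i : MvPolynomial (Fin n) k) ^ V c i j) f = monomial (d c) 1 * θ c)
    (hθp : ∀ c, Prime (θ c)) (hcop : ∀ c (i : Fin n), ¬ (X i ∣ θ c))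
    (B : Finset (Fin n →₀ ℕ)) (b : Fin t → (Fin n →₀ ℕ)) (hbB : ∀ c, b c ∈ B)
    (hgeB : ∀ (c : Fin t), ∀ e ∈ B, (Finsupp.equivFunOnFinite.symm ((V c).mulVec ⇑(b c)) : Fin n →₀ ℕ) ≤ Finsupp.equivFunOnFinite.symm ((V c).mulVec ⇑e)) :
    IsEffectiveCartier ((affineBlowup.idealSheaf (Ideal.span ((fun e : Fin n →₀ ℕ => Ideal.Quotient.mk (Ideal.span {f}) (monomial e (1 : k))) '' (B : Set (Fin n →₀ ℕ))))).comap
      (affineBlowup.π (Ideal.span ((fun e : Fin n →₀ ℕ => Ideal.Quotient.mk (Ideal.span {f}) (monomial e (1 : k))) '' (A : Set (Fin n →₀ ℕ)))))) := by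
  intro x
  obtain ⟨c, hc⟩ := MonomialChartSections.exists_mem_chartOpen _ hv hcov x
  obtain ⟨Φ, hΦ⟩ := PencilChartPackage.exists_sections_ringEquiv_of_isPrime f (V c) (hV c) (m c) (a c) (hgen c) A (haA c) (hge c) (d c) (θ c) (hθ c) hprime hXne (hcop c) (hv c)
  obtain ⟨γ, hγ, hI⟩ := ChartPrincipalIdeal.exists_generator_of_chart f (V c) (m c) A (θ c) (hv c) (hθp c) (hcop c) Φ hΦ B (b c) (hbB c) (hgeB c)
  exact ⟨_, hc, γ, hγ, hI⟩

end Summit.ResolutionOfSingularities.ResolutionOfSingularities.Theorems.FInjectiveMacaulayfication.ClassCentreInvertible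

end
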